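import Literature.MathematicalPhysics.QuantumFieldTheory.Balaban1983to89.Node00.Record11
import Literature.MathematicalPhysics.QuantumFieldTheory.Balaban1983to89.B14NodeKnitTowerDatum

/-!
# `Balaban1983to89.B14NodeKnitRecord11R` — YM-DAG node N11 · [Balaban1988Convergent] CMP **119** (1988) 243–285, Theorem 1 p. 262 (with the Theorem
# of p. 245 and the ASSUMED operation 𝐑 of p. 244) AT NODE 00's STAGE-11 RECORD `Node00.IsRecordOfRecord₁₁C`, IN [III]'s OWN DENSITY-LEVEL CURRENCY
# (`B14.RAssumedP244`, `B14.ThmP245PrintedI`, the induction `B14.inductiveAssumptions_of_thmP245`), 𝐑 DISPLAYED EXACTLY AS PRINT ASSUMES IT —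
# the «relative to 𝐑» closer: Theorem 1 at the objects of record from the p. 244 assumption + the start + the Theorem of p. 245, nothing else

statement-level bookkeeping over published theorems with citation tags; kernel-checked compositions of tree theorems;
nothing here is a claim about the Yang–Mills mass gap.

CITATION HEADER (lean-in-tree rule).  Source: T. Bałaban, *Convergent renormalization expansions for lattice gauge theories*, Commun. Math. Phys. **119**,
243–285 (1988), doi:10.1007/bf01217741 [Balaban1988Convergent] (cell paper B14 = «[III]» of [Balaban1989LargeFieldI] ∕ [Balaban1989LargeFieldII]): p. 244
(𝐑 assumed), the Theorem of p. 245, (2.18) p. 257, Thm 1 and the remarks p. 262, (3.25) p. 270.  Seat `pub-ymgap-dag-n11-e` (YM-PLAN Track A, HUMAN RULING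
D-0062; director-ym R134 fan-out row N11∕s3 «`ThmP245Printed` via `rOperation` from N13's `ROpLeaf`»; dag-lead FAN-OUT v1.1 §N11 s3 «PRINT-FAITHFUL 𝐑-AS-HYPOTHESIS:
the node sentence with 𝐑 displayed exactly as print assumes it (no pin discharge) — the honest relative-to-𝐑 closer»).  BY NAME and UNCHANGED: `…Node00.Record11`
(seat node00-def-T: `Stage11Params`, `Provisos₁₁`, `VOfRecord₁₁`, `SLaw₁₁`, `TLaw₁₁`, `sLaw₁₁_iff`, `rOpLeaf_VOfRecord₁₁_iff`, `coreOfRecord₁₁`, `towerOfRecord₁₁`,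
`datumOfRecord₁₁`, `upOfRecord₅C … (θ.toStage5₁₁ F N)`, `IsRecordOfRecord₁₁C`, `HasSect2FormAE`), `…Node00.Record10` (`densOfRecord₁₀`, `tdensOfRecord₁₀`),
`…B14` (the cell's typed skeleton of [III]: `RAssumedP244` :398 — p. 244 verbatim —, `ThmP245Printed` :375 ∕ `ThmP245PrintedI` :470 — the Theorem of p. 245
verbatim —, `inductiveAssumptions_of_thmP245` :421 — Thm 1 ⇐ start + p. 245 Theorem + assumed 𝐑 along (0.2)), `…DagBinding` (`ROpLeaf` :1128 = `B14.RAssumedP244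
V.R V.Scorr V.S V.K` BY DEFINITION, `rOpLeaf_iff`, `leavesP`, `WorldP`), `…B14NodeKnitTowerDatum` (seat dag-n11-a: `b14_main_at_datumOfTower_of_propTower`,
`densitiesDescribed_iff_core`), `…Dag` (`B14_main` :224).

THE NODE (Dag.lean :224): `B14_main ℓ := ℓ.b7 → ℓ.b8 → ℓ.b9 → ℓ.b10 → ℓ.b11 → (ℓ.smallCouplings → ℓ.smallFieldInductive) → (ℓ.smallCouplings → ℓ.flowControl) →
(ℓ.rOperation → (ℓ.smallCouplings → ℓ.densitiesDescribed))`.  𝐑 is an ANTECEDENT of N11 (print, p. 244 [PDF 2], verbatim: *«The operation 𝐑 serves this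
purpose. We will not describe it here, we will only assume that it has some properties incorporated in the inductive description of the effective actions.»*);
node N13 ([Balaban1989LargeFieldII] Thm 1) PRODUCES it.  At a Stage-11 record the antecedent `(leavesP w P).rOperation` IS, by the C-binding of record over the
Stage-11 view, the leaf `DagBinding.ROpLeaf (Node00.VOfRecord₁₁ F N θ P)` (§1, `Iff.rfl`) — THE JUNCTION PROP WITH N13 BY NAME (seat dag-n13-c inhabits it; this
file consumes it) —, and that leaf IS `B14.RAssumedP244 (VOfRecord₁₁ …).R (VOfRecord₁₁ …).Scorr (VOfRecord₁₁ …).S P.K`, [III]'s own typing of the p. 244 sentence,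
at the 𝐑-carriers of record (§1, `Iff.rfl`).

WHY THIS FILE (what s3 adds next to s1∕s2).  The seat-dag-n11-a lineage (`B14NodeKnitTowerDatum` → `…Record9`; the s1 consumer at ₁₁) states N11 in SLOT currency
(laws of the (2.18) slot families, T-step∕R-step of record) and DISCHARGES the (𝐑) antecedent's READING by the pin `rOperation_upOfRecord₅C_stage11_iff` (the leaf
unfolded into law transport `TLaw₁₁ k → SLaw₁₁ (k+1)`).  Here nothing is unfolded inside a statement: 𝐑 stays the Prop print assumes — `RAssumedP244` at the carriers
of record ∕ `ROpLeaf (VOfRecord₁₁ …)` — displayed as a HYPOTHESIS of the Theorem-1 closer (§3: no world, no binding, only the objects of record `θ`, `P`), and, at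
the node, CONSUMED FROM N11's OWN ANTECEDENT through that Prop by name (§4: load-bearing, not discarded, not re-derived).  §2 identifies [III]'s three sentences at
the objects of record: the Theorem of p. 245 (sequence reading along the trajectory of record, `𝐓ρ_k :=` the T-image of record `tdensOfRecord₁₀`; and [III]'s own
slot name `B14.ThmP245PrintedI T ρ S Scorr K` for ANY transformation family `T` agreeing with the tower on the trajectory) ↔ `∀ k < K, SLaw₁₁ k → TLaw₁₁ k`; the
p. 244 assumption ↔ `∀ k < K, TLaw₁₁ k → SLaw₁₁ (k+1)` (node00-def-T's `rOpLeaf_VOfRecord₁₁_iff`, quoted); Thm 1's conclusion `densitiesDescribed` at a bound world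
↔ `∀ k ≤ K, SLaw₁₁ k` = the PINNED §2 [III] form (a.e. reading `HasSect2FormAE`) of every `ρ_k`'s slot family (n11-a's `densitiesDescribed_iff_core`; the ₁₁
name is n11-c's, see OWNERSHIP) — so a referee compares s1's pinned discharge with the print-faithful reading on one page.

WHAT THIS FILE PROVES (0 `sorry`, 0 `def`, standard axioms; every ingredient BY NAME).
§1 `rOperation_iff_rOpLeaf₁₁` · `rOpLeaf₁₁_iff_rAssumedP244` (both `Iff.rfl` after the binding equation) · `rOpLeaf₁₁_of_b16_main` (the producer's side: node
   N13's statement at a Stage-11-bound run, with its in-edges, YIELDS the leaf at the carriers of record — the Prop seat dag-n13-c inhabits, by name).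
§2 `thmP245_at_record₁₁_iff_laws` · `thmP245PrintedI_at_record₁₁_iff_laws` · `rAssumedP244_at_record₁₁_iff_laws`.
§3 **`sLaw₁₁_all_of_rAssumedP244`** — THEOREM 1 [III] AT THE OBJECTS OF RECORD, RELATIVE TO 𝐑: `RAssumedP244` at `VOfRecord₁₁ θ P` + `SLaw₁₁ θ P 0` + (∀ k < K,
   `SLaw₁₁ θ P k → TLaw₁₁ θ P k`) ⊢ `∀ k ≤ K, SLaw₁₁ θ P k` (the induction of `B14.inductiveAssumptions_of_thmP245`, re-run at the laws of record);
   `hasSect2FormAE_all_of_rAssumedP244` (what that SAYS: every `ρ_k`'s slot family has the §2 form); `densitiesDescribed_at_record₁₁_of_rOpLeaf` (at a bound world).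
§4 **`b14_main_at_record₁₁_of_rOpLeaf`** (THE NODE at any world bound to the datum of record whose `rOperation` antecedent names the leaf — 𝐑 consumed from its
   own antecedent through `ROpLeaf (VOfRecord₁₁ …)`), `sLaw₁₁_all_of_b14_main_of_rOpLeaf` (A4 locator: what N11 SAYS at ₁₁ given its antecedents, the 𝐑 one AS
   PRINT ASSUMES IT), **`sLaw₁₁_all_of_b16_main_of_slots`** (Thm 1 at a Stage-11-bound run from node N13's statement — which yields the leaf, §1 — N11's two printed
   slots and the remaining antecedents: the N11∕N13 junction BY NAME, as `Dag.uv_stability_of_series` composes it).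
OWNERSHIP (dedup, one public name per object).  The `hup`-keyed node statement `b14_main_at_record₁₁`, the unfolding `densitiesDescribed_iff_sLaw₁₁`, N11 unfolded
`b14_main_iff_at_record₁₁`, the keyed form `b14_main_of_isRecordOfRecord₁₁C` and the route stub `s_N11_rec₁₁C` are seat dag-n11-c's
`Summits/QuantumFields/YangMills/Theorems/BalabanUVNodesN11AtRecord11C.lean` (p450088, slot∕law-transport currency); they are NOT restated here (this Literature module
cannot import them; where a proof needs the unfolding it quotes n11-a's `B14NodeKnitTowerDatum.densitiesDescribed_iff_core`).

HONEST FRAMING.  A count-neutral SLOT landing (R429 (4)(i)): N11 is NOT discharged here.  (S1ᵀ) — the Theorem of p. 245 at the objects of record, i.e. Sects. 1–3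
of [Balaban1988Convergent] for the pinned §2 form `HasSect2FormAE` ∕ 𝐓-image form `HasSect2FormTAE` of the slot families of record — is a DISPLAYED HYPOTHESIS;
(S0) — the Wilson start has the §2 form at index 0 — likewise; 𝐑 is the printed ASSUMPTION of p. 244 (node N13's product; [Balaban1989LargeFieldII] Thm 1), displayed,
never discharged.  The `T`-family face of §2 quantifies over `∀ k, RTOpI (F.P P.K) k (SU N) (avOfRecord F N P.K k)`, a type the tree inhabits today only level-wise in
the standing range `k < K` (`Node00.avOfRecord_haarAC`; located in `B14NodeKnitMachine`'s header) — it is a dictionary lemma, not used by the closers, which are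
`T`-free.  One finite four-torus programme at fixed `ε`, Bałaban AS PRINTED with locators; nothing continuum ∕ ℝ⁴ ∕ OS ∕ mass gap ∕ Clay.
-/

noncomputable section

open MeasureTheory
open scoped BigOperators Matrix.Norms.L2Operator

namespace Literature.MathematicalPhysics.QuantumFieldTheory.Balaban1983to89.B14NodeKnitRecord11R

open DagBinding T4DatumAssembly T4Continuum Node00
open B14NodeKnitTowerDatum (b14_main_at_datumOfTower_of_propTower densitiesDescribed_iff_core)

variable (F : T4Family) (N : ℕ) [NeZero N]

/-! ## §1. The 𝐑-antecedent at Stage 11, PRINT-FAITHFUL: the leaf at the carriers of record, by name, and as [III]'s p. 244 sentence -/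

section Leaf

variable (θ : Stage11Params F N) (w : WorldP) (P : B12.RunParams)

/-- **THE 𝐑-ANTECEDENT OF N11 AT A STAGE-11-BOUND RUN IS THE LEAF AT THE CARRIERS OF RECORD** (the junction Prop with N13, BY NAME): at `w.up P = upOfRecord₅C F N
(θ.toStage5₁₁ F N) P`, `(leavesP w P).rOperation ↔ ROpLeaf (VOfRecord₁₁ F N θ P)` — [Balaban1988Convergent] p. 244's assumed 𝐑 for the run, at the pinned 𝐑-carriers
(`Iff.rfl` behind the binding equation; nothing unfolded). [cite: Balaban1988Convergent, p.244 (bookkeeping: the leaf named)] -/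
theorem rOperation_iff_rOpLeaf₁₁ (hup : w.up P = upOfRecord₅C F N (θ.toStage5₁₁ F N) P) :
    (leavesP w P).rOperation ↔ ROpLeaf (VOfRecord₁₁ F N θ P) := by
  show (w.up P).rOperation ↔ _
  rw [hup]
  exact Iff.rfl

/-- **THE LEAF AT THE CARRIERS OF RECORD IS [III]'s TYPED p. 244 SENTENCE** (`B14.RAssumedP244`, verbatim there: *«we will only assume that it has some properties
incorporated in the inductive description of the effective actions»* — `∀ k < K, ∀ ρ′, Scorr (k+1) ρ′ → S (k+1) (R k ρ′)`) for the density operation, target space and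
corresponding space OF RECORD along the run `P` (`Iff.rfl`: `DagBinding.ROpLeaf` is this by definition). [cite: Balaban1988Convergent, p.244] -/
theorem rOpLeaf₁₁_iff_rAssumedP244 :
    ROpLeaf (VOfRecord₁₁ F N θ P) ↔
      B14.RAssumedP244 (VOfRecord₁₁ F N θ P).R (VOfRecord₁₁ F N θ P).Scorr (VOfRecord₁₁ F N θ P).S P.K :=
  Iff.rfl

/-- **THE PRODUCER'S SIDE OF THE JUNCTION** (node N13 = [Balaban1989LargeFieldII] Thm 1, `Dag.B16_main` :253, whose conclusion's first conjunct is
`ℓ.rOperation`): at a Stage-11-bound run, N13's node statement with its in-edge leaves `b5 b6 b7 b9 b10 b11 b13`, the basic step `rBasicStep` ([Balaban1989LargeFieldI])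
and the small-field implication YIELDS the leaf at the carriers of record `ROpLeaf (VOfRecord₁₁ F N θ P)` — the Prop seat dag-n13-c is asked to inhabit, BY NAME
(A4 locator for N13's 𝐑-product in the print-faithful reading; the unfolded law-transport form is node00-def-T's `rOpLeaf_VOfRecord₁₁_iff`).
[cite: Balaban1989LargeFieldII, Thm 1 p.355 (bookkeeping); Balaban1988Convergent, p.244] -/
theorem rOpLeaf₁₁_of_b16_main (hup : w.up P = upOfRecord₅C F N (θ.toStage5₁₁ F N) P) (hN : Dag.B16_main (leavesP w P))
    (h5 : (leavesP w P).b5) (h6 : (leavesP w P).b6) (h7 : (leavesP w P).b7) (h9 : (leavesP w P).b9) (h10 : (leavesP w P).b10)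
    (h11 : (leavesP w P).b11) (h13 : (leavesP w P).b13) (hrb : (leavesP w P).rBasicStep)
    (hsf : (leavesP w P).smallCouplings → (leavesP w P).smallFieldInductive) :
    ROpLeaf (VOfRecord₁₁ F N θ P) :=
  (rOperation_iff_rOpLeaf₁₁ F N θ w P hup).1 (hN h5 h6 h7 h9 h10 h11 h13 hrb hsf).1

end Leaf

/-! ## §2. [III]'s three sentences READ AT THE OBJECTS OF RECORD: the Theorem of p. 245, the p. 244 assumption, Theorem 1's conclusion -/

section Sentences

variable (θ : Stage11Params F N) (w : WorldP) (P : B12.RunParams)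

/-- **THE THEOREM OF p. 245, SEQUENCE READING, ALONG THE TRAJECTORY OF RECORD** ([Balaban1988Convergent] p. 245 [PDF 3], verbatim: *«Theorem. If ρ_k satisfies the
assumptions described in detail in Sect. 2, then Tρ_k satisfies also the corresponding assumptions.»*): with `ρ_k := densOfRecord₁₀ … P k` in the target space of
record (`(VOfRecord₁₁ …).S k`) and `𝐓ρ_k :=` the T-image of record `tdensOfRecord₁₀ … P k` ((3.25) p. 270) tested in the corresponding space (`(VOfRecord₁₁ …).Scorr
(k+1)`), the sentence IS «§2 form at `k` ⇒ 𝐓-image form at `k`», `∀ k < K, SLaw₁₁ θ P k → TLaw₁₁ θ P k`.  Bookkeeping. [cite: Balaban1988Convergent, Theorem p.245; (3.25) p.270] -/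
theorem thmP245_at_record₁₁_iff_laws :
    (∀ k, k < P.K → (VOfRecord₁₁ F N θ P).S k (densOfRecord₁₀ F N θ.toStage9Params P k) →
        (VOfRecord₁₁ F N θ P).Scorr (k + 1) (tdensOfRecord₁₀ F N θ.toStage9Params P k)) ↔
      ∀ k, k < P.K → SLaw₁₁ F N θ P k → TLaw₁₁ F N θ P k := by
  refine ⟨fun h k hk hS => ?_, fun h k hk hS => ?_⟩
  · have hT : tdensOfRecord₁₀ F N θ.toStage9Params P k = tdensOfRecord₁₀ F N θ.toStage9Params P k ∧ TLaw₁₁ F N θ P k :=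
      h k hk ⟨rfl, hS⟩
    exact hT.2
  · exact ⟨rfl, h k hk hS.2⟩

/-- **[III]'s OWN SLOT NAME AT THE RECORD**: for ANY family `T` of renormalization transformations on the run's lattices (the cell's inhabited carrier `Setup.RTOpI`
along the averaging of record) that AGREES WITH THE TOWER ON THE TRAJECTORY (`(T k).T ρ_k = 𝐓ρ_k` of record, `k < K`), the typed Theorem of p. 245
`B14.ThmP245PrintedI T ρ S Scorr K` (sequence reading, [Balaban1988Convergent] p. 245 verbatim in `…B14`) at `ρ := densOfRecord₁₀ … P`, the spaces of record and
`K := P.K` IS `∀ k < K, SLaw₁₁ θ P k → TLaw₁₁ θ P k`.  (The `RTOp`-form `B14.ThmP245Printed` :375 is the same Prop along `RTOp.toRTOpI`, `B14.thmP245PrintedI_toRTOpI_iff`.)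
A dictionary lemma; the closers below are `T`-free. [cite: Balaban1988Convergent, Theorem p.245] -/
theorem thmP245PrintedI_at_record₁₁_iff_laws (T : (k : ℕ) → RTOpI (F.P P.K) k (SU N) (avOfRecord F N P.K k))
    (hT : ∀ k, k < P.K → (T k).T (densOfRecord₁₀ F N θ.toStage9Params P k) = tdensOfRecord₁₀ F N θ.toStage9Params P k) :
    B14.ThmP245PrintedI T (densOfRecord₁₀ F N θ.toStage9Params P) (VOfRecord₁₁ F N θ P).S (VOfRecord₁₁ F N θ P).Scorr P.K ↔
      ∀ k, k < P.K → SLaw₁₁ F N θ P k → TLaw₁₁ F N θ P k := by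
  refine ⟨fun h k hk hS => ?_, fun h k hk hS => ?_⟩
  · have hT' : (T k).T (densOfRecord₁₀ F N θ.toStage9Params P k) = tdensOfRecord₁₀ F N θ.toStage9Params P k ∧ TLaw₁₁ F N θ P k :=
      h k hk ⟨rfl, hS⟩
    exact hT'.2
  · exact ⟨hT k hk, h k hk hS.2⟩

/-- **THE p. 244 ASSUMPTION AT THE CARRIERS OF RECORD IS «𝐓-IMAGE FORM ⇒ §2 FORM ONE LEVEL UP»**: `B14.RAssumedP244` at `VOfRecord₁₁ θ P` ↔ `∀ k < K, TLaw₁₁ θ P k →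
SLaw₁₁ θ P (k+1)` — node00-def-T's `rOpLeaf_VOfRecord₁₁_iff`, quoted through §1 ([Balaban1988Convergent] Thm 2's statement shape at the objects of record; what
[Balaban1989LargeFieldII] Thm 1 proves). [cite: Balaban1988Convergent, p.244 and Thm 2 p.263 (bookkeeping: the leaf unfolded, by name)] -/
theorem rAssumedP244_at_record₁₁_iff_laws :
    B14.RAssumedP244 (VOfRecord₁₁ F N θ P).R (VOfRecord₁₁ F N θ P).Scorr (VOfRecord₁₁ F N θ P).S P.K ↔
      ∀ k, k < P.K → TLaw₁₁ F N θ P k → SLaw₁₁ F N θ P (k + 1) :=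
  (rOpLeaf₁₁_iff_rAssumedP244 F N θ P).symm.trans (rOpLeaf_VOfRecord₁₁_iff F N θ P)

end Sentences

/-! ## §3. THEOREM 1 [III] AT THE OBJECTS OF RECORD, RELATIVE TO 𝐑 — no world, no binding: the Stage-11 parameters `θ` and the run `P` only -/

section Thm1Relative

variable (θ : Stage11Params F N) (P : B12.RunParams)

/-- **THEOREM 1 [III] AT THE OBJECTS OF RECORD, RELATIVE TO 𝐑** ([Balaban1988Convergent] Thm 1 p. 262 [PDF 20], verbatim: *«… the sequence of densities {ρ_k},
generated by successive applications of the operations 𝐑T to the density ρ₀ = exp[−(1∕g₀²)A − E], satisfies all the inductive assumptions»*; its printed proof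
structure = the START + THE THEOREM OF p. 245 at every step + THE ASSUMED 𝐑 along (0.2), kernel-checked in `…B14` as `inductiveAssumptions_of_thmP245`; here the same
induction RE-RUN AT THE LAWS OF RECORD).  Hypotheses, all DISPLAYED and PRINTED: `hR` — p. 244's assumption typed by [III]'s module, `B14.RAssumedP244`, at the
𝐑-carriers of record `VOfRecord₁₁ θ P` (= `ROpLeaf (VOfRecord₁₁ …)`, N13's product); `h0` — the Wilson start `ρ₀` of record has the §2 form at index 0; `hT` — the
Theorem of p. 245 at the objects of record (§2): a §2-form `ρ_k` of record has its 𝐓-image of record in the corresponding space, `k < K`.  Conclusion: EVERY `ρ_k`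
of record, `k ≤ K`, has the §2 [III] form of record.  Count-neutral; nothing of Sects. 1–3 asserted. [cite: Balaban1988Convergent, Thm 1 p.262; Theorem p.245; p.244] -/
theorem sLaw₁₁_all_of_rAssumedP244
    (hR : B14.RAssumedP244 (VOfRecord₁₁ F N θ P).R (VOfRecord₁₁ F N θ P).Scorr (VOfRecord₁₁ F N θ P).S P.K)
    (h0 : SLaw₁₁ F N θ P 0) (hT : ∀ k, k < P.K → SLaw₁₁ F N θ P k → TLaw₁₁ F N θ P k) :
    ∀ k, k ≤ P.K → SLaw₁₁ F N θ P k := by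
  have hR' : ∀ k, k < P.K → TLaw₁₁ F N θ P k → SLaw₁₁ F N θ P (k + 1) :=
    (rAssumedP244_at_record₁₁_iff_laws F N θ P).1 hR
  intro k
  induction k with
  | zero => exact fun _ => h0
  | succ n ih =>
    intro hk
    exact hR' n (Nat.lt_of_succ_le hk) (hT n (Nat.lt_of_succ_le hk) (ih (Nat.le_of_succ_le hk)))

/-- **What Theorem 1 SAYS at Stage 11, relative to 𝐑**: under the three displayed hypotheses of `sLaw₁₁_all_of_rAssumedP244`, for every `k ≤ K` the post-𝐑 slot
family of `ρ_k` of record HAS THE §2 [III] FORM (a.e. reading `Node00.HasSect2FormAE`: localized terms `𝐄^{(i)}, 𝐑^{(i)}, 𝐁^{(i)}` obeying (2.27)–(2.28), (2.31),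
(2.41)–(2.42) on the spaces of record, universal 𝐄, `slot_k(s) = 𝐓_k(s) exp A_k(s)` a.e. on the χ-support) — `Node00.sLaw₁₁_iff`. [cite: Balaban1988Convergent, Thm 1 p.262, (2.18) p.257, (2.23)–(2.42) pp.258–261] -/
theorem hasSect2FormAE_all_of_rAssumedP244
    (hR : B14.RAssumedP244 (VOfRecord₁₁ F N θ P).R (VOfRecord₁₁ F N θ P).Scorr (VOfRecord₁₁ F N θ P).S P.K)
    (h0 : SLaw₁₁ F N θ P 0) (hT : ∀ k, k < P.K → SLaw₁₁ F N θ P k → TLaw₁₁ F N θ P k) (k : ℕ) (hk : k ≤ P.K) :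
    HasSect2FormAE F N (FluctV N) P.K (settingOfRecord₁₁ F N θ P) (θ.Rz P.K) (θ.Wt P.K) k
      (UbgOfRecord₁₁ F N θ P k)
      (slotsOfRecord F N θ.ν θ.τ9 (EOfRecord₁₀ F N θ.toStage9Params) (wOfRecord₉ F N θ.toStage9Params) θ.ppSel P
        (gOfRecord₁₀ F N θ.toStage9Params P) k) :=
  (sLaw₁₁_iff F N θ P k).1 (sLaw₁₁_all_of_rAssumedP244 F N θ P hR h0 hT k hk)

variable (w : WorldP) (h : θ.Provisos₁₁)

/-- **Theorem 1's conclusion `densitiesDescribed` AT A STAGE-11 WORLD, RELATIVE TO 𝐑** — with 𝐑 displayed as THE LEAF AT THE CARRIERS OF RECORD `ROpLeaf (VOfRecord₁₁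
F N θ P)` (the Prop node N13 produces): at `w.C = (datumOfRecord₁₁ F N θ h).C`, the leaf + the start + the Theorem of p. 245 at the objects of record give
`(leavesP w P).densitiesDescribed`. [cite: Balaban1988Convergent, Thm 1 p.262; Theorem p.245; p.244] -/
theorem densitiesDescribed_at_record₁₁_of_rOpLeaf (hC : w.C = (datumOfRecord₁₁ F N θ h).C) (hR : ROpLeaf (VOfRecord₁₁ F N θ P))
    (h0 : SLaw₁₁ F N θ P 0) (hT : ∀ k, k < P.K → SLaw₁₁ F N θ P k → TLaw₁₁ F N θ P k) :
    (leavesP w P).densitiesDescribed :=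
  (densitiesDescribed_iff_core F N (coreOfRecord₁₁ F N θ) (towerOfRecord₁₁ F N θ h) w P hC).2
    (sLaw₁₁_all_of_rAssumedP244 F N θ P ((rOpLeaf₁₁_iff_rAssumedP244 F N θ P).1 hR) h0 hT)

end Thm1Relative

/-! ## §4. THE NODE at a Stage-11 world: 𝐑 consumed FROM N11's OWN ANTECEDENT through the leaf at the carriers of record; the N11∕N13 junction by name -/

section Node

variable (θ : Stage11Params F N) (h : θ.Provisos₁₁) (w : WorldP) (P : B12.RunParams)

/-- **N11 · `Dag.B14_main (leavesP w P)` AT A STAGE-11 WORLD, 𝐑 PRINT-FAITHFUL** ([Balaban1988Convergent] Thm 1 p. 262 with the Theorem of p. 245 and the assumed 𝐑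
of p. 244, at NODE 00's Stage-11 objects of record).  Pins: `hC` the world is bound to the datum of record; (P1) `hV` the run's `rOperation` antecedent names the leaf
at the carriers of record `ROpLeaf (VOfRecord₁₁ F N θ P)` (at the C-binding of record: §1, `rOperation_iff_rOpLeaf₁₁`).  Slots, DISPLAYED and PRINTED: (S0) `h0` —
under the interval hypothesis the Wilson start `ρ₀` of record has the §2 form (`SLaw₁₁ … 0`); (S1ᵀ) `hT` — THE THEOREM OF p. 245 at the objects of record GIVEN the
node's in-edges `b7 … b11` ([12] = B7, [14] = B8, [13] = B9, [16] = B10, [15] = B11), the interval hypothesis, the small-field inductive assumptions ([I], [II]) and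
the flow control (2.6): `∀ k < K, SLaw₁₁ … k → TLaw₁₁ … k`.  The (𝐑) step of the induction is SUPPLIED BY THE NODE'S OWN ANTECEDENT read through the leaf (p. 244's
sentence at the carriers of record, `rOpLeaf_VOfRecord₁₁_iff`) — load-bearing, not discarded, not a hypothesis of this theorem.  Composition:
`B14NodeKnitTowerDatum.b14_main_at_datumOfTower_of_propTower` at `InS := SLaw₁₁ θ P`, `InT := TLaw₁₁ θ P` (the datum of record IS `datumOfTower F N (coreOfRecord₁₁
…) (towerOfRecord₁₁ …)`, `rfl`).  Count-neutral slot landing. [cite: Balaban1988Convergent, Thm 1 p.262; Theorem p.245; p.244] -/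
theorem b14_main_at_record₁₁_of_rOpLeaf (hC : w.C = (datumOfRecord₁₁ F N θ h).C)
    (hV : (leavesP w P).rOperation → ROpLeaf (VOfRecord₁₁ F N θ P))
    (h0 : (leavesP w P).smallCouplings → SLaw₁₁ F N θ P 0)
    (hT : (leavesP w P).b7 → (leavesP w P).b8 → (leavesP w P).b9 → (leavesP w P).b10 → (leavesP w P).b11 →
      (leavesP w P).smallCouplings → (leavesP w P).smallFieldInductive → (leavesP w P).flowControl →
        ∀ k, k < P.K → SLaw₁₁ F N θ P k → TLaw₁₁ F N θ P k) :
    Dag.B14_main (leavesP w P) :=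
  b14_main_at_datumOfTower_of_propTower F N (coreOfRecord₁₁ F N θ) (towerOfRecord₁₁ F N θ h) w P hC
    (SLaw₁₁ F N θ P) (TLaw₁₁ F N θ P) (fun _ _ hS => hS) h0 hT
    (fun hrop => (rOpLeaf_VOfRecord₁₁_iff F N θ P).1 (hV hrop))

/-- **What N11 SAYS at Stage 11, the 𝐑-antecedent AS PRINT ASSUMES IT** (A4 locator, vacuity audit in kernel form): N11 at a world bound to the datum of record,
GIVEN its in-edge leaves, the small-field implication, the located flow step, the interval hypothesis, the reading (P1) `hV` AND THE LEAF AT THE CARRIERS OF RECORD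
`ROpLeaf (VOfRecord₁₁ F N θ P)` — node N13's product, by name — YIELDS the pinned §2 [III] form of every `ρ_k` of record, `∀ k ≤ K, SLaw₁₁ θ P k` (not closable by a
trivially true format: `SLaw₁₁` is `HasSect2FormAE` of the slot family of record).  The law-transport reading of the same locator is seat dag-n11-c's
`BalabanUVNodesN11AtRecord11C.sLaw₁₁_all_of_b14_main` (Summits side). [cite: Balaban1988Convergent, Thm 1 p.262 (bookkeeping); p.244] -/
theorem sLaw₁₁_all_of_b14_main_of_rOpLeaf (hC : w.C = (datumOfRecord₁₁ F N θ h).C) (hV : ROpLeaf (VOfRecord₁₁ F N θ P) → (leavesP w P).rOperation)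
    (hN : Dag.B14_main (leavesP w P))
    (h7 : (leavesP w P).b7) (h8 : (leavesP w P).b8) (h9 : (leavesP w P).b9) (h10 : (leavesP w P).b10) (h11 : (leavesP w P).b11)
    (hsf : (leavesP w P).smallCouplings → (leavesP w P).smallFieldInductive)
    (hfc : (leavesP w P).smallCouplings → (leavesP w P).flowControl)
    (hR : ROpLeaf (VOfRecord₁₁ F N θ P)) (hsc : (leavesP w P).smallCouplings) :
    ∀ k, k ≤ P.K → SLaw₁₁ F N θ P k :=
  (densitiesDescribed_iff_core F N (coreOfRecord₁₁ F N θ) (towerOfRecord₁₁ F N θ h) w P hC).1 (hN h7 h8 h9 h10 h11 hsf hfc (hV hR) hsc)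

/-- **THEOREM 1 [III] AT A STAGE-11-BOUND RUN FROM THE TWO NODES' PRINTED PRODUCTS, the junction BY NAME** (how `Dag.uv_stability_of_series` hands N13's product to
N11, read at the objects of record): at a run bound by `w.up P = upOfRecord₅C F N (θ.toStage5₁₁ F N) P` (no construction clause needed), GIVEN node N13's statement
`Dag.B16_main (leavesP w P)` with ITS in-edge leaves `b5 b6 b7 b9 b10 b11 b13` and `rBasicStep` ([Balaban1989LargeFieldI]; N12's product) — which YIELDS the leaf
`ROpLeaf (VOfRecord₁₁ F N θ P)` (§1) —, N11's slots (S0), (S1ᵀ) at the objects of record and N11's remaining antecedents `b8`, the small-field implication and the located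
flow step: under the interval hypothesis EVERY `ρ_k` of record, `k ≤ K`, has the §2 [III] form of record.  Pure composition; both nodes' analytic contents stay
displayed. [cite: Balaban1988Convergent, Thm 1 p.262; Theorem p.245; p.244; Balaban1989LargeFieldII, Thm 1 p.355] -/
theorem sLaw₁₁_all_of_b16_main_of_slots (hup : w.up P = upOfRecord₅C F N (θ.toStage5₁₁ F N) P)
    (hN13 : Dag.B16_main (leavesP w P))
    (h5 : (leavesP w P).b5) (h6 : (leavesP w P).b6) (h7 : (leavesP w P).b7) (h8 : (leavesP w P).b8) (h9 : (leavesP w P).b9)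
    (h10 : (leavesP w P).b10) (h11 : (leavesP w P).b11) (h13 : (leavesP w P).b13) (hrb : (leavesP w P).rBasicStep)
    (hsf : (leavesP w P).smallCouplings → (leavesP w P).smallFieldInductive)
    (hfc : (leavesP w P).smallCouplings → (leavesP w P).flowControl)
    (h0 : (leavesP w P).smallCouplings → SLaw₁₁ F N θ P 0)
    (hT : (leavesP w P).b7 → (leavesP w P).b8 → (leavesP w P).b9 → (leavesP w P).b10 → (leavesP w P).b11 →
      (leavesP w P).smallCouplings → (leavesP w P).smallFieldInductive → (leavesP w P).flowControl →
        ∀ k, k < P.K → SLaw₁₁ F N θ P k → TLaw₁₁ F N θ P k)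
    (hsc : (leavesP w P).smallCouplings) : ∀ k, k ≤ P.K → SLaw₁₁ F N θ P k :=
  have hR : ROpLeaf (VOfRecord₁₁ F N θ P) := rOpLeaf₁₁_of_b16_main F N θ w P hup hN13 h5 h6 h7 h9 h10 h11 h13 hrb hsf
  sLaw₁₁_all_of_rAssumedP244 F N θ P ((rOpLeaf₁₁_iff_rAssumedP244 F N θ P).1 hR) (h0 hsc)
    (hT h7 h8 h9 h10 h11 hsc (hsf hsc) (hfc hsc))

end Node

end Literature.MathematicalPhysics.QuantumFieldTheory.Balaban1983to89.B14NodeKnitRecord11R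

end
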